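import Summits.KontsevichZagierPeriods.KontsevichZagierPeriods.Theorems.SoloInformedNashSymbol
import Literature.NumberTheory.Transcendental.EllIterRep

/-!
# The span of the `κ̃` of Nash symbols; periods of representations in `V` (Rung 2, file E5a)

Solo programme `solo-KontsevichZagierPeriods-informed`, bookkeeping for step L4 of
`paper/rung2-v2.md`: the subgroup `soloInformedKappaSpan ≤ V` generated by the values `κ̃(σ)` on
Nash symbols, the fact that its elements are signed sums `∑ εᵢ κ̃(σᵢ)` (the shape required by
`SoloInformedPlanarPieces`), and the additivity of `Per(ρ) = (⟦ρ⟧, 0) ∈ V` along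
Kontsevich–Zagier relations. [Kontsevich–Zagier 2001, §1.2; Huber–Wüstholz 2022, §13.1]
-/

noncomputable section

open Set Filter Topology MeasureTheory
open scoped Polynomial
open Literature.NumberTheory.Transcendental Literature.NumberTheory.Transcendental.KZ
open Literature.NumberTheory.Transcendental.CurvePeriods Literature.ModelTheory.ExponentialFields

namespace Summit.KontsevichZagierPeriods.KontsevichZagierPeriods.Theorems


/-! ## 1. The span of the `κ̃` of Nash symbols -/

open Classical in
/-- `κ̂(σ) = κ̃(σ)` for a Nash symbol `σ`, and `0` otherwise (a proof-free wrapper). -/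
def soloInformedKappaHat (σ : PeriodSymbol) : SoloInformedV :=
  if h : SoloInformedIsNashPath σ.γ.toFun then soloInformedKappaTilde σ h else 0

/-- `κ̂ = κ̃` on Nash symbols. -/
theorem soloInformedKappaHat_eq (σ : PeriodSymbol) (h : SoloInformedIsNashPath σ.γ.toFun) :
    soloInformedKappaHat σ = soloInformedKappaTilde σ h := by
  unfold soloInformedKappaHat
  rw [dif_pos h]

/-- **The subgroup of `V` generated by the `κ̃(σ)`, `σ` a Nash symbol.** -/
def soloInformedKappaSpan : AddSubgroup SoloInformedV :=
  AddSubgroup.closure {v | ∃ (σ : PeriodSymbol) (h : SoloInformedIsNashPath σ.γ.toFun),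
    v = soloInformedKappaTilde σ h}

/-- Generators lie in the span. -/
theorem soloInformed_kappaTilde_mem_span (σ : PeriodSymbol)
    (h : SoloInformedIsNashPath σ.γ.toFun) :
    soloInformedKappaTilde σ h ∈ soloInformedKappaSpan :=
  AddSubgroup.subset_closure ⟨σ, h, rfl⟩

/-- **Elements of the span are signed sums of `κ̃` of Nash symbols.** -/
theorem soloInformed_exists_sum_of_mem_span {v : SoloInformedV} (hv : v ∈ soloInformedKappaSpan) :
    ∃ (k : ℕ) (σ : Fin k → PeriodSymbol) (ε : Fin k → ℤ)
      (hN : ∀ i, SoloInformedIsNashPath (σ i).γ.toFun),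
      v = ∑ i, ε i • soloInformedKappaTilde (σ i) (hN i) := by
  suffices h : ∃ (k : ℕ) (σ : Fin k → PeriodSymbol) (ε : Fin k → ℤ),
      (∀ i, SoloInformedIsNashPath (σ i).γ.toFun) ∧
        v = ∑ i, ε i • soloInformedKappaHat (σ i) by
    obtain ⟨k, σ, ε, hN, h⟩ := h
    exact ⟨k, σ, ε, hN, h.trans (Finset.sum_congr rfl fun i _ => by
      rw [soloInformedKappaHat_eq _ (hN i)])⟩
  induction hv using AddSubgroup.closure_induction with
  | mem x hx =>
    obtain ⟨σ, h, rfl⟩ := hx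
    exact ⟨1, fun _ => σ, fun _ => 1, fun _ => h, by simp [soloInformedKappaHat_eq σ h]⟩
  | zero => exact ⟨0, Fin.elim0, Fin.elim0, fun i => i.elim0, by simp⟩
  | add x y _ _ hx hy =>
    obtain ⟨k, σ, ε, hN, rfl⟩ := hx
    obtain ⟨l, τ, δ, hM, rfl⟩ := hy
    refine ⟨k + l, Fin.append σ τ, Fin.append ε δ, fun i => ?_, ?_⟩
    · refine Fin.addCases (fun i => ?_) (fun i => ?_) i
      · rw [Fin.append_left]
        exact hN i
      · rw [Fin.append_right]
        exact hM i
    · rw [Fin.sum_univ_add]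
      simp only [Fin.append_left, Fin.append_right]
  | neg x _ hx =>
    obtain ⟨k, σ, ε, hN, rfl⟩ := hx
    refine ⟨k, σ, fun i => -ε i, hN, ?_⟩
    simp only [neg_zsmul, Finset.sum_neg_distrib]

/-! ## 2. Periods of representations in `V` -/

/-- `Per(ρ) = (⟦ρ⟧, 0) ∈ V`. -/
def soloInformedPer {n : ℕ} (ρ : IntegralRep n) : SoloInformedV :=
  SoloInformedV.mk (toFormalPeriod (of ρ)) 0

/-- Equivalent representations have the same `Per`. -/
theorem soloInformedPer_congr {n : ℕ} {ρ ρ' : IntegralRep n}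
    (h : of ρ - of ρ' ∈ relations) :
    soloInformedPer ρ = soloInformedPer ρ' := by
  simp only [soloInformedPer, toFormalPeriod_eq_iff.2 h]

/-- `Per` is additive along a two-piece relation. -/
theorem soloInformedPer_add {n : ℕ} {ρ ρ₁ ρ₂ : IntegralRep n}
    (h : of ρ - of ρ₁ - of ρ₂ ∈ relations) :
    soloInformedPer ρ = soloInformedPer ρ₁ + soloInformedPer ρ₂ := by
  have h' : toFormalPeriod (of ρ) = toFormalPeriod (of ρ₁ + of ρ₂) :=
    toFormalPeriod_eq_iff.2 (by rw [← sub_sub]; exact h)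
  simp only [soloInformedPer, h', map_add, SoloInformedV.mk_add_mk, add_zero]

/-- `Per` is additive along a finite-sum relation (any dimensions). -/
theorem soloInformedPer_sum {n m : ℕ} {ι : Type*} (s : Finset ι) {ρ : IntegralRep n}
    {R : ι → IntegralRep m} (h : of ρ - ∑ i ∈ s, of (R i) ∈ relations) :
    soloInformedPer ρ = ∑ i ∈ s, soloInformedPer (R i) := by
  refine SoloInformedV.ext ?_ ?_
  · simp only [soloInformedPer, SoloInformedV.fst_mk, SoloInformedV.fst_sum]
    rw [← map_sum]
    exact toFormalPeriod_eq_iff.2 h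
  · simp [soloInformedPer]

/-- Restrictions to equal sets are equal. -/
theorem soloInformed_restrict_congr {n : ℕ} (r : IntegralRep n) {s t : Set (Fin n → ℝ)}
    (h : s = t) (hs : IsSemialgebraic ℚ s) (hsr : s ⊆ r.domain) (ht : IsSemialgebraic ℚ t)
    (htr : t ⊆ r.domain) : r.restrict s hs hsr = r.restrict t ht htr := by
  subst h
  rfl

/-- Open intervals with algebraic end points are `ℚ`-semialgebraic in `ℝ¹`. -/
theorem soloInformed_isSemialgebraic_Ioo1 {α β : ℝ} (hα : IsAlgebraic ℚ α)
    (hβ : IsAlgebraic ℚ β) :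
    IsSemialgebraic ℚ (soloInformedIoo1 α β) := by
  have h : soloInformedIoo1 α β = {x : Fin 1 → ℝ | α < x 0} ∩ {x | x 0 < β} := by
    ext x
    simp [soloInformed_mem_Ioo1]
  rw [h]
  exact (isSemialgebraic_setOf_const_lt_apply hα 0).inter
    (isSemialgebraic_setOf_apply_lt_const hβ 0)

end Summit.KontsevichZagierPeriods.KontsevichZagierPeriods.Theorems
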